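import Summits.CriticalPhenomena.PercolationContinuityZ3.Theorems.PercNearOneGluingNoHeavyLowerTailSahiCombReadOnce

/-!
# The comb (tensor-Bernstein) hierarchy for Sahi's `E_k`, XIII: (M⁺-3) — Kahn's Conjecture 5 at the comb level — for every triple of
# UNIONS (or intersections) OF INDEPENDENT EVENTS, from ONE kernel certificate on seven coins

Support file of the one-cut programme (crux `NoHeavyLowerTail`, stmt-CriticalPhenomena-4575; cell `prim-masterthm`, seat P3, gen 3;
`run/shared/lean/prim/prim-masterthm/prim-masterthm-p3/HIERARCHY.md` §10).  Vocabulary: `SahiComb.CombPos`; the read-once substitution theorem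
`SahiCombReadOnce.CombPos.readOnce` (`…SahiCombReadOnce`); prim-sahi's three-copy digit certificate `SahiC3Cube.checkTriple` and its comb form
`SahiC3CombCube.combPos_sahiE_three_of_checkTriple`.

THE POINT.  Three events of the form `U_k = ⋃_{a ∈ A_k} H_a` (`k = 0,1,2`), the `H_a` determined by pairwise disjoint coordinate sets (INDEPENDENT under every product
measure; not necessarily monotone), are the read-once substitution of the gadgets `G_T = ⋃_{a : {k | a ∈ A_k} = T} H_a` (`∅ ≠ T ⊆ {0,1,2}`, seven of them) into the
fixed triple `B_k = {ξ ⊆ 7 | ∃ T ∈ ξ, k ∈ T}` of increasing events of the SEVEN-point cube.  So (M⁺-3) for the whole class — every cube, every product measure, all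
`A_0, A_1, A_2` — follows from comb positivity of ONE triple on `{0,1}^7`, which is a kernel-checked digit certificate (`decide`, ≈ 5 s; all `4^7` three-copy fibre sums of
`E_3(1_{B_0},1_{B_1},1_{B_2})` are `≥ 0`).  The same for each of the `2^3` union/intersection patterns (member `k` the union OR the intersection of its gadgets).
* `certs_venn` — the eight 7-coin certificates (kernel `decide`); `encA_eq_ofBits` — bitmask of an event from a Boolean membership test;
* `combPos_sahiE_three_vennBase` — (M⁺-3) for the eight base triples on `Fin 7`;
* **`combPos_sahiE_three_venn`** — for gadgets `G r` (`r : Fin 7`, code `r+1 ↔ T`) determined by the fibres of any `π : ι → Fin 7` and any pattern `u : Fin 3 → Bool`: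
  `E_3` of `(⋃ or ⋂)_{r : bit_k(r+1)} G r` (`k = 0,1,2`) is comb-positive at multidegree `3`;
* **`combPos_sahiE_three_unions`** — **for every finite family `(H_a)` of events with pairwise disjoint determining sets and all `A_0, A_1, A_2`, the triple
  `(⋃_{A_0} H, ⋃_{A_1} H, ⋃_{A_2} H)` satisfies (M⁺-3)**; law-level shadows `sahiE_three_nonneg_unions`, `sahiE3_nonneg_unions` (Sahi's `E_3 ≥ 0`, Kahn's Conjecture 5
  instance, every product measure);
* **`combPos_sahiE_three_or`** — the coordinate case: `E_3(1_{ω ∩ S_0 ≠ ∅}, 1_{ω ∩ S_1 ≠ ∅}, 1_{ω ∩ S_2 ≠ ∅})` is comb-positive for all `S_0, S_1, S_2 ⊆ ι` ("OR-triples";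
  the `|ι| = 3` OR-triangle is the unique hard-core triple of l12-p3's domination census on three coins, and generic OR-triples lie in the residual class of every
  stratum of `…SahiCombStrata`: antichain, pairwise dependent, no cylinder, no member containing the meet of the others).
HONEST FRAMING: nothing here asserts (M⁺-k) or `C_k` for `k ≥ 3` in general. [this work]
-/

noncomputable section

namespace Summit.CriticalPhenomena.PercolationContinuityZ3.Theorems

open Finset Function MeasureTheory
open Literature.Combinatorics.Sahi2008
open Literature.Probability.LatticeModels (prodBernoulli sahiE3)
open Literature.Probability.Percolation (DeterminedBy determinedBy_iff determinedBy_univ)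
open Literature.Probability.Percolation.DecisionTree (ind ind_of_mem ind_of_not_mem ind_nonneg)
open SahiComb SahiCombTensor SahiCombReadOnce SahiC3Cube

namespace SahiCombVenn

/-! ### The seven-coin certificates -/

/-- The bitmask of an event of the cube `Fin m` from a Boolean membership test on positions. [this work] -/
theorem encA_eq_ofBits {m : ℕ} {A : Set (Set (Fin m))} (f : ℕ → Bool) (hf : ∀ x, x < 2 ^ m → (pt m x ∈ A ↔ f x = true)) :
    encA m A = ofBits f (2 ^ m) := by
  classical
  refine Nat.eq_of_testBit_eq fun x => ?_
  rw [testBit_encA, testBit_ofBits]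
  by_cases hx : x < 2 ^ m
  · have h := hf x hx
    by_cases hfx : f x = true
    · rw [hfx, decide_eq_true (h.2 hfx)]
    · have hfx' : f x = false := by simpa using hfx
      rw [hfx', decide_eq_false (fun hA => hfx (h.1 hA))]
  · simp [hx]

/-- **The eight seven-coin certificates** (kernel `decide`): for each union/intersection pattern `(u₀,u₁,u₂)` the three-copy digit test of the base triple passes
(bitmasks: member `k` contains the point `x < 128` iff `x` meets / contains the mask of the codes `r+1 ∋ k`; masks `85, 102, 120`). [this work] -/
theorem certs_venn : ∀ u₀ u₁ u₂ : Bool,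
    checkTriple 26 7
      (ofBits (fun x => bif u₀ then decide (x &&& (![85, 102, 120] (0 : Fin 3)) ≠ 0)
        else decide (x &&& (![85, 102, 120] (0 : Fin 3)) = ![85, 102, 120] (0 : Fin 3))) (2 ^ 7))
      (ofBits (fun x => bif u₁ then decide (x &&& (![85, 102, 120] (1 : Fin 3)) ≠ 0)
        else decide (x &&& (![85, 102, 120] (1 : Fin 3)) = ![85, 102, 120] (1 : Fin 3))) (2 ^ 7))
      (ofBits (fun x => bif u₂ then decide (x &&& (![85, 102, 120] (2 : Fin 3)) ≠ 0)
        else decide (x &&& (![85, 102, 120] (2 : Fin 3)) = ![85, 102, 120] (2 : Fin 3))) (2 ^ 7)) = true := by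
  decide +kernel

/-- Membership of the point `x < 128` in the base events, union mode, as a mask test (kernel `decide`). [this work] -/
theorem vennBase_mem_union : ∀ (k : Fin 3) (x : ℕ), x < 2 ^ 7 →
    ((∃ r : Fin 7, x.testBit r = true ∧ (r.1 + 1).testBit k = true) ↔ decide (x &&& (![85, 102, 120] k) ≠ 0) = true) := by
  decide

/-- Membership of the point `x < 128` in the base events, intersection mode, as a mask test (kernel `decide`). [this work] -/
theorem vennBase_mem_inter : ∀ (k : Fin 3) (x : ℕ), x < 2 ^ 7 →
    ((∀ r : Fin 7, (r.1 + 1).testBit k = true → x.testBit r = true) ↔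
      decide (x &&& (![85, 102, 120] k) = ![85, 102, 120] k) = true) := by
  decide

/-- The base events on the seven-point cube — member `k` in union mode `{ξ | ∃ r ∈ ξ, k ∈ code(r+1)}` / intersection mode `{ξ | ∀ r, k ∈ code(r+1) → r ∈ ξ}` —
have the announced bitmasks. [this work] -/
theorem encA_vennBase (k : Fin 3) (u : Bool) :
    encA 7 (bif u then {ξ : Set (Fin 7) | ∃ r ∈ ξ, (r.1 + 1).testBit k = true} else {ξ : Set (Fin 7) | ∀ r : Fin 7, (r.1 + 1).testBit k = true → r ∈ ξ}) =
      ofBits (fun x => bif u then decide (x &&& (![85, 102, 120] k) ≠ 0) else decide (x &&& (![85, 102, 120] k) = ![85, 102, 120] k)) (2 ^ 7) := by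
  refine encA_eq_ofBits _ fun x hx => ?_
  cases u
  · simpa only [cond_false, Set.mem_setOf_eq, pt] using vennBase_mem_inter k x hx
  · simpa only [cond_true, Set.mem_setOf_eq, pt, exists_prop] using vennBase_mem_union k x hx

/-- The certificates in event form: the digit test passes on the bitmasks of the base events. [this work] -/
theorem certs_venn_encA (u : Fin 3 → Bool) :
    checkTriple 26 7
      (encA 7 (bif u 0 then {ξ : Set (Fin 7) | ∃ r ∈ ξ, (r.1 + 1).testBit ((0 : Fin 3) : ℕ) = true}
        else {ξ : Set (Fin 7) | ∀ r : Fin 7, (r.1 + 1).testBit ((0 : Fin 3) : ℕ) = true → r ∈ ξ}))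
      (encA 7 (bif u 1 then {ξ : Set (Fin 7) | ∃ r ∈ ξ, (r.1 + 1).testBit ((1 : Fin 3) : ℕ) = true}
        else {ξ : Set (Fin 7) | ∀ r : Fin 7, (r.1 + 1).testBit ((1 : Fin 3) : ℕ) = true → r ∈ ξ}))
      (encA 7 (bif u 2 then {ξ : Set (Fin 7) | ∃ r ∈ ξ, (r.1 + 1).testBit ((2 : Fin 3) : ℕ) = true}
        else {ξ : Set (Fin 7) | ∀ r : Fin 7, (r.1 + 1).testBit ((2 : Fin 3) : ℕ) = true → r ∈ ξ})) = true := by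
  have e0 := encA_vennBase 0 (u 0)
  have e1 := encA_vennBase 1 (u 1)
  have e2 := encA_vennBase 2 (u 2)
  generalize encA 7 _ = a0 at e0 ⊢
  generalize encA 7 _ = a1 at e1 ⊢
  generalize encA 7 _ = a2 at e2 ⊢
  subst e0 e1 e2
  exact certs_venn (u 0) (u 1) (u 2)

/-- **(M⁺-3) for the eight base triples on `{0,1}^7`.** [this work] -/
theorem combPos_sahiE_three_vennBase (u : Fin 3 → Bool) :
    CombPos (fun _ : Fin 7 => 3) (fun p => sahiE (bernoulliWeight p) 3 (fun k => ind
      (bif u k then {ξ : Set (Fin 7) | ∃ r ∈ ξ, (r.1 + 1).testBit k = true}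
        else {ξ : Set (Fin 7) | ∀ r : Fin 7, (r.1 + 1).testBit k = true → r ∈ ξ}))) := by
  refine (SahiC3CombCube.combPos_sahiE_three_of_checkTriple (certs_venn_encA u)).congr fun p => ?_
  congr 1; funext k; fin_cases k <;> rfl

/-! ### Read-once transfer: unions / intersections of independent events -/

variable {ι : Type} [Fintype ι]

omit [Fintype ι] in
/-- Substituting gadgets into a union-mode / intersection-mode base event gives the union / intersection of the gadgets with the corresponding codes. [this work] -/
theorem readOnce_vennBase (G : Fin 7 → Set (Set ι)) (k : Fin 3) (u : Bool) :
    {ω : Set ι | {r | ω ∈ G r} ∈ (bif u then {ξ : Set (Fin 7) | ∃ r ∈ ξ, (r.1 + 1).testBit k = true}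
        else {ξ : Set (Fin 7) | ∀ r : Fin 7, (r.1 + 1).testBit k = true → r ∈ ξ})} =
      (bif u then ⋃ (r : Fin 7) (_ : (r.1 + 1).testBit k = true), G r else ⋂ (r : Fin 7) (_ : (r.1 + 1).testBit k = true), G r) := by
  cases u
  · ext ω; simp only [cond_false, Set.mem_setOf_eq, Set.mem_iInter]
  · ext ω
    simp only [cond_true, Set.mem_setOf_eq, Set.mem_iUnion, exists_prop]
    constructor <;> rintro ⟨r, h1, h2⟩ <;> exact ⟨r, h2, h1⟩

/-- **(M⁺-3) for every Venn pattern of independent gadgets.**  For gadgets `G r` (`r : Fin 7`) determined by the fibres of `π : ι → Fin 7` and a pattern `u : Fin 3 → Bool`,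
the triple whose member `k` is the UNION (`u k = true`) or the INTERSECTION (`u k = false`) of the gadgets `G r` with `k ∈ code(r+1)` has `E_3` comb-positive at multidegree
`3`. [this work] -/
theorem combPos_sahiE_three_venn (π : ι → Fin 7) (G : Fin 7 → Set (Set ι)) (hG : ∀ r, DeterminedBy (G r) {i | π i = r}) (u : Fin 3 → Bool) :
    CombPos (fun _ : ι => 3) (fun q => sahiE (bernoulliWeight q) 3 (fun k => ind
      (bif u k then ⋃ (r : Fin 7) (_ : (r.1 + 1).testBit k = true), G r else ⋂ (r : Fin 7) (_ : (r.1 + 1).testBit k = true), G r))) := by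
  refine (CombPos.readOnce π G hG (combPos_sahiE_three_vennBase u)).congr fun q => ?_
  congr 1; funext k; rw [readOnce_vennBase]

/-! ### Unions of an arbitrary independent family -/

section Unions

variable {A : Type} [Fintype A]

omit [Fintype ι] [Fintype A] in
/-- The Venn code of an index: `[a ∈ A_0] + 2[a ∈ A_1] + 4[a ∈ A_2]` is at most `7`. [folklore] -/
theorem code_le [DecidableEq A] (𝒜 : Fin 3 → Finset A) (a : A) :
    (if a ∈ 𝒜 0 then 1 else 0) + (if a ∈ 𝒜 1 then 2 else 0) + (if a ∈ 𝒜 2 then 4 else 0) ≤ 7 := by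
  split_ifs <;> omega

omit [Fintype ι] [Fintype A] in
/-- The bits of the Venn code are the memberships. [folklore] -/
theorem testBit_code [DecidableEq A] (𝒜 : Fin 3 → Finset A) (a : A) (k : Fin 3) :
    ((if a ∈ 𝒜 0 then 1 else 0) + (if a ∈ 𝒜 1 then 2 else 0) + (if a ∈ 𝒜 2 then 4 else 0)).testBit k = true ↔ a ∈ 𝒜 k := by
  fin_cases k <;> by_cases h0 : a ∈ 𝒜 0 <;> by_cases h1 : a ∈ 𝒜 1 <;> by_cases h2 : a ∈ 𝒜 2 <;> simp [h0, h1, h2] <;> decide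

/-- **(M⁺-3) FOR UNIONS OF INDEPENDENT EVENTS.**  Let `(H_a)_{a ∈ A}` be events of a finite cube determined by pairwise disjoint coordinate sets `D_a` (so independent
under every product measure; no monotonicity needed) and `A_0, A_1, A_2 ⊆ A` arbitrary.  Then `q ↦ E_3(μ_q; 1_{⋃_{A_0} H}, 1_{⋃_{A_1} H}, 1_{⋃_{A_2} H})` is a nonnegative
combination of the degree-3 tensor-Bernstein basis on `[0,1]^ι` (Kahn's Conjecture 5 at the comb level on this class). [this work] -/
theorem combPos_sahiE_three_unions (H : A → Set (Set ι)) (D : A → Finset ι) (hD : ∀ a b, a ≠ b → Disjoint (D a) (D b))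
    (hH : ∀ a, DeterminedBy (H a) (↑(D a) : Set ι)) (𝒜 : Fin 3 → Finset A) :
    CombPos (fun _ : ι => 3) (fun q => sahiE (bernoulliWeight q) 3 (fun k => ind (⋃ a ∈ 𝒜 k, H a))) := by
  classical
  -- Venn codes, the projection `π` and the seven gadgets
  let code : A → ℕ := fun a => (if a ∈ 𝒜 0 then 1 else 0) + (if a ∈ 𝒜 1 then 2 else 0) + (if a ∈ 𝒜 2 then 4 else 0)
  have hcode7 : ∀ a, code a ≤ 7 := fun a => code_le 𝒜 a
  have hbit : ∀ a (k : Fin 3), (code a).testBit k = true ↔ a ∈ 𝒜 k := fun a k => testBit_code 𝒜 a k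
  let π : ι → Fin 7 := fun i => if h : ∃ a, i ∈ D a ∧ code a ≠ 0 then ⟨code h.choose - 1, by have := hcode7 h.choose; omega⟩ else 0
  let G : Fin 7 → Set (Set ι) := fun r => ⋃ (a : A) (_ : code a = r.1 + 1), H a
  -- the owner of a coordinate is unique
  have howner : ∀ {i a}, i ∈ D a → code a ≠ 0 → π i = ⟨code a - 1, by have := hcode7 a; omega⟩ := by
    intro i a hi hca
    have hex : ∃ a, i ∈ D a ∧ code a ≠ 0 := ⟨a, hi, hca⟩
    have hπ : π i = ⟨code hex.choose - 1, by have := hcode7 hex.choose; omega⟩ := dif_pos hex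
    have ha : hex.choose = a := by
      by_contra hne
      exact Finset.disjoint_left.1 (hD _ _ hne) hex.choose_spec.1 hi
    rw [hπ]; exact Fin.ext (by simp only [ha])
  have hG : ∀ r, DeterminedBy (G r) {i | π i = r} := by
    intro r
    rw [determinedBy_iff]
    intro ω ω' hωω'
    simp only [G, Set.mem_iUnion, exists_prop]
    refine exists_congr fun a => and_congr_right fun hca => ?_
    refine (determinedBy_iff _ _).1 (hH a) ω ω' ?_
    have hsub : (↑(D a) : Set ι) ⊆ {i | π i = r} := fun i hi => by
      have hca0 : code a ≠ 0 := by omega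
      simp only [Set.mem_setOf_eq, howner (Finset.mem_coe.1 hi) hca0]
      exact Fin.ext (by simp only [hca]; omega)
    rw [← Set.inter_eq_self_of_subset_right hsub, ← Set.inter_assoc, ← Set.inter_assoc, hωω']
  have h := combPos_sahiE_three_venn π G hG (fun _ => true)
  refine h.congr fun q => ?_
  congr 1; funext k
  simp only [cond_true]
  congr 1
  ext ω
  simp only [G, Set.mem_iUnion, exists_prop]
  constructor
  · rintro ⟨a, ha, hω⟩
    have hca : (code a).testBit k = true := (hbit a k).2 ha
    have hca0 : code a ≠ 0 := fun h0 => by rw [h0] at hca; simp at hca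
    refine ⟨⟨code a - 1, by have := hcode7 a; omega⟩, ?_, a, by simp only; omega, hω⟩
    have : code a - 1 + 1 = code a := by omega
    simp only [this, hca]
  · rintro ⟨r, hr, a, hca, hω⟩
    exact ⟨a, (hbit a k).1 (by rw [hca]; exact hr), hω⟩

/-- Law-level shadow (functional form): `E_3(μ_q; 1_{⋃_{A_0} H}, 1_{⋃_{A_1} H}, 1_{⋃_{A_2} H}) ≥ 0` for every product measure. [this work] -/
theorem sahiE_three_nonneg_unions (q : ι → unitInterval) (H : A → Set (Set ι)) (D : A → Finset ι)
    (hD : ∀ a b, a ≠ b → Disjoint (D a) (D b)) (hH : ∀ a, DeterminedBy (H a) (↑(D a) : Set ι)) (𝒜 : Fin 3 → Finset A) :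
    0 ≤ sahiE (bernoulliWeight q) 3 (fun k => ind (⋃ a ∈ 𝒜 k, H a)) :=
  (combPos_sahiE_three_unions H D hD hH 𝒜).nonneg q

/-- **Sahi's `E_3 ≥ 0` (Kahn's Conjecture 5 instance) for unions of independent events**, event form: for events `H_a` with pairwise disjoint determining sets and any
`A_0, A_1, A_2`, `sahiE3 (prodBernoulli q) (⋃_{A_0} H) (⋃_{A_1} H) (⋃_{A_2} H) ≥ 0`. [this work] -/
theorem sahiE3_nonneg_unions (q : ι → unitInterval) (H : A → Set (Set ι)) (D : A → Finset ι)
    (hD : ∀ a b, a ≠ b → Disjoint (D a) (D b)) (hH : ∀ a, DeterminedBy (H a) (↑(D a) : Set ι)) (A₀ A₁ A₂ : Finset A) :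
    0 ≤ sahiE3 (prodBernoulli q) (⋃ a ∈ A₀, H a) (⋃ a ∈ A₁, H a) (⋃ a ∈ A₂, H a) := by
  have h := sahiE_three_nonneg_unions q H D hD hH ![A₀, A₁, A₂]
  have hfam : (fun k => ind (⋃ a ∈ (![A₀, A₁, A₂] : Fin 3 → Finset A) k, H a)) =
      ![ind (⋃ a ∈ A₀, H a), ind (⋃ a ∈ A₁, H a), ind (⋃ a ∈ A₂, H a)] := by
    funext k; fin_cases k <;> rfl
  rwa [hfam, sahiE_three_ind] at h

end Unions

/-! ### OR-triples of coordinates -/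

/-- **(M⁺-3) FOR OR-TRIPLES**: for all `S_0, S_1, S_2 ⊆ ι`, `q ↦ E_3(μ_q; 1_{ω ∩ S_0 ≠ ∅}, 1_{ω ∩ S_1 ≠ ∅}, 1_{ω ∩ S_2 ≠ ∅})` is comb-positive at multidegree `3` — the
three-partition / three-copy-fibre level (★★) of Kahn's Conjecture 5 for every triple of disjunctions of coordinates, on every finite cube. [this work] -/
theorem combPos_sahiE_three_or (S : Fin 3 → Finset ι) :
    CombPos (fun _ : ι => 3) (fun q => sahiE (bernoulliWeight q) 3 (fun k => ind {ω : Set ι | ∃ i ∈ S k, i ∈ ω})) := by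
  classical
  have h := combPos_sahiE_three_unions (A := ι) (fun i => {ω : Set ι | i ∈ ω}) (fun i => {i})
    (fun a b hab => Finset.disjoint_singleton.2 hab) (fun i => (determinedBy_iff _ _).2 fun ω ω' hωω' => ?_) S
  · refine h.congr fun q => ?_
    congr 1; funext k; congr 1; ext ω
    simp only [Set.mem_setOf_eq, Set.mem_iUnion, exists_prop]
  · have h1 := Set.ext_iff.1 hωω' i
    simp only [Finset.coe_singleton, Set.mem_inter_iff, Set.mem_singleton_iff, and_true, Set.mem_setOf_eq] at h1 ⊢
    exact h1

/-- Law-level shadow: Sahi's `E_3 ≥ 0` for OR-triples of coordinates, every product measure on every finite cube. [this work] -/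
theorem sahiE_three_nonneg_or (q : ι → unitInterval) (S : Fin 3 → Finset ι) :
    0 ≤ sahiE (bernoulliWeight q) 3 (fun k => ind {ω : Set ι | ∃ i ∈ S k, i ∈ ω}) :=
  (combPos_sahiE_three_or S).nonneg q

end SahiCombVenn

end Summit.CriticalPhenomena.PercolationContinuityZ3.Theorems

end
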